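import Summits.QuantumAdvantage.QuantumAdvantage.Theorems.CharDialColumnDialB1
import HarnessLib

/-!
# CharDial — the SYMMETRIC-BLOCK LAW (part B2): ★ CASE II

Tree twin, part B2 (§3.6b, ★ `caseII`), of the decomp-qadv lens-5 g34 node `Theses/ColumnDial.lean`; imports part B1.  CASE II — an active
group `a` (a co-point pattern): with `i = max` of the first `a` block positions and `j = min` of the rest, the transposition `u ↦ u ∘ swap i j`
preserves the fibre, fixes every output and shifts the addresses of exactly the cuts of group `a` by `±1`, reversing the outcome on the flip
set (`flip_iff_twoSet`); the involution pairing and the two-slice count give `≥ 2^|S|/(6p) − 2^|S|·cos(π/3p)^L` losers on the fibre.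
Kernel-checked, no `sorry`, no instances, no notation.  Memo: decomp-qadv-lens-5/g34/NODE-g34.md (§9 proof map, §10 land package); blueprint BLUEPRINT-g34.md.  Re-cut of the staged part B (cf96495d) at section boundaries (≤ 400 lines per file, every declaration docstringed); declaration bodies byte-identical.
-/

set_option autoImplicit false
set_option linter.dupNamespace false

namespace Summit.QuantumAdvantage.QuantumAdvantage.Theorems.ColumnDial

open Finset
open Summit.QuantumAdvantage.AdviceFreeQNC0

section Law

variable {n : ℕ}

/-- ★ CASE II. -/
theorem caseII {p : ℕ} (hp : 1 ≤ p) (h3p : Nat.Coprime 3 p) {S : Finset (Fin n)}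
    {y : Fin (n + 1) → (Fin n → Bool) → Bool} (hS : SymBlock p S y) (c : ℕ)
    {z : Fin n → Bool} (hz : ∀ k ∈ S, z k = false) {μ : ZMod p} {u₀ : Fin n → Bool} (hu₀ : u₀ ∈ Xf p S z μ)
    {a : ℕ} (ha1 : 1 ≤ a) (ham : a < S.card) {ρ : ZMod 3}
    (hρ : ∀ t, phasePat (fired S y u₀ a) (eZ c S u₀) t = decide (t ≠ ρ)) {L : ℕ} (hL : 2 * L + 2 ≤ S.card) :
    (2 : ℝ) ^ S.card / (6 * p) - (2 : ℝ) ^ S.card * (Real.cos (Real.pi / (3 * p))) ^ L ≤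
      (((Xf p S z μ).filter fun u => ringWinU c y u = false).card : ℝ) := by
  obtain ⟨hC0, hC1⟩ := Summit.QuantumAdvantage.AdviceFreeQNC0.JLinPeel.TokenDial.cos_facts hp
  obtain ⟨g₀, hg₀⟩ := exists_rep_of_copoint hρ
  have hu₀f : u₀ ∈ fib S z := (mem_Xf.1 hu₀).1
  -- the transposed pair: `i` = the last of the first `a` block positions, `j` = the first of the others
  have hPcard : (pre S g₀).card = a := hg₀
  have hPne : (pre S g₀).Nonempty := Finset.card_pos.1 (by omega)
  have hQcard : (S \ pre S g₀).card + a = S.card := by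
    rw [← hPcard]; exact Finset.card_sdiff_add_card_eq_card (pre_subset S g₀)
  have hQne : (S \ pre S g₀).Nonempty := Finset.card_pos.1 (by omega)
  obtain ⟨i, hi_def⟩ : ∃ i : Fin n, i = (pre S g₀).max' hPne := ⟨_, rfl⟩
  obtain ⟨j, hj_def⟩ : ∃ j : Fin n, j = (S \ pre S g₀).min' hQne := ⟨_, rfl⟩
  have hiP : i ∈ pre S g₀ := by rw [hi_def]; exact Finset.max'_mem _ hPne
  have hjQ : j ∈ S \ pre S g₀ := by rw [hj_def]; exact Finset.min'_mem _ hQne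
  have hiS : i ∈ S := (mem_pre.1 hiP).1
  have hig₀ : i.val < g₀.val := (mem_pre.1 hiP).2
  have hjS : j ∈ S := (Finset.mem_sdiff.1 hjQ).1
  have hjP : j ∉ pre S g₀ := (Finset.mem_sdiff.1 hjQ).2
  have hg₀j : g₀.val ≤ j.val := by
    by_contra h
    exact hjP (mem_pre.2 ⟨hjS, by omega⟩)
  have hij : i ≠ j := fun e => hjP (e ▸ hiP)
  -- the cuts strictly after `i` and at or before `j` are exactly the group `a`
  have hkappa_of_mid : ∀ g : Fin (n + 1), i.val < g.val → g.val ≤ j.val → kappa S g = a := by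
    intro g h1 h2
    rw [← hPcard]
    unfold kappa
    congr 1
    ext s
    rw [mem_pre, mem_pre]
    constructor
    · rintro ⟨hsS, hsg⟩
      refine ⟨hsS, ?_⟩
      by_contra hs
      have hsQ : s ∈ S \ pre S g₀ := Finset.mem_sdiff.2 ⟨hsS, fun h => hs (mem_pre.1 h).2⟩
      have hjs : j ≤ s := by rw [hj_def]; exact Finset.min'_le _ s hsQ
      rw [Fin.le_def] at hjs
      omega
    · rintro ⟨hsS, hsg₀⟩
      have hsi : s ≤ i := by rw [hi_def]; exact Finset.le_max' _ s (mem_pre.2 ⟨hsS, hsg₀⟩)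
      rw [Fin.le_def] at hsi
      exact ⟨hsS, by omega⟩
  have hout : ∀ g : Fin (n + 1), kappa S g ≠ a → (i.val < g.val ↔ j.val < g.val) := by
    intro g hg
    constructor
    · intro h1
      by_contra h2
      exact hg (hkappa_of_mid g h1 (by omega))
    · intro h2; omega
  -- the involution `u ↦ u ∘ swap i j`
  have hTf : ∀ u ∈ fib S z, u ∘ Equiv.swap i j ∈ fib S z := by
    intro u hu
    rw [mem_fib] at hu ⊢
    intro k hk
    have hki : k ≠ i := fun e => hk (e ▸ hiS)
    have hkj : k ≠ j := fun e => hk (e ▸ hjS)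
    show u (Equiv.swap i j k) = z k
    rw [Equiv.swap_apply_of_ne_of_ne hki hkj, hu k hk]
  have hTX : ∀ u ∈ Xf p S z μ, u ∘ Equiv.swap i j ∈ Xf p S z μ := by
    intro u hu
    rw [mem_Xf] at hu ⊢
    exact ⟨hTf u hu.1, by rw [SubChar.bw_comp_swap hiS hjS u]; exact hu.2⟩
  have hTT : ∀ u : Fin n → Bool, (u ∘ Equiv.swap i j) ∘ Equiv.swap i j = u := by
    intro u; funext k; simp [Function.comp, Equiv.swap_apply_self]
  -- the score: group `a` + the rest; the rest is swap-invariant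
  have ha_mem : a ∈ range (S.card + 1) := Finset.mem_range.2 (by omega)
  have hsum : ∀ v : Fin n → Bool, (dset c y v).card =
      (dgrp c S y v a).card + ∑ k ∈ (range (S.card + 1)).erase a, (dgrp c S y v k).card := by
    intro v
    rw [card_dset_eq_sum c S y v, ← Finset.add_sum_erase _ _ ha_mem]
  have hR : ∀ u : Fin n → Bool, ∑ k ∈ (range (S.card + 1)).erase a, (dgrp c S y (u ∘ Equiv.swap i j) k).card =
      ∑ k ∈ (range (S.card + 1)).erase a, (dgrp c S y u k).card := by
    intro u
    refine Finset.sum_congr rfl fun k hk => ?_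
    have hka : k ≠ a := Finset.ne_of_mem_erase hk
    have hset : dgrp c S y (u ∘ Equiv.swap i j) k = dgrp c S y u k := by
      ext g
      simp only [dgrp, dset, Finset.mem_filter, Finset.mem_univ, true_and]
      constructor
      · rintro ⟨⟨hy, hA⟩, hk'⟩
        have hκ : kappa S g ≠ a := by rw [hk']; exact hka
        rw [symBlock_swap hS hiS hjS g u] at hy
        rw [walkExp_comp_swap_out i j u (hout g hκ)] at hA
        exact ⟨⟨hy, hA⟩, hk'⟩
      · rintro ⟨⟨hy, hA⟩, hk'⟩
        have hκ : kappa S g ≠ a := by rw [hk']; exact hka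
        refine ⟨⟨?_, ?_⟩, hk'⟩
        · rw [symBlock_swap hS hiS hjS g u]; exact hy
        · rw [walkExp_comp_swap_out i j u (hout g hκ)]; exact hA
    rw [hset]
  -- the win bit in the fibre: bell `a` at the common shift, XOR the invariant rest
  have hpar : ∀ v ∈ Xf p S z μ, ringWinU c y v =
      (decide ((((SubChar.bw S v + SubChar.bw (pre S g₀) v : ℕ)) : ZMod 3) ≠ ρ) ^^
        decide ((∑ k ∈ (range (S.card + 1)).erase a, (dgrp c S y v k).card) % 2 = 1)) := by
    intro v hv
    rw [ringWinU_eq, hsum v, SumCodeZero.decide_add_mod_two, decide_dgrp c S y v hg₀, fired_eq_of_mem_Xf hS hv hu₀,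
      eZ_eq_of_mem_fib (mem_Xf.1 hv).1 hu₀f, hρ]
  have key : ∀ A B R : Bool, (A ^^ B) = true → (A ^^ R) ≠ (B ^^ R) := by decide
  have hPi : ∀ u : Fin n → Bool,
      SubChar.bw (pre S g₀) u = (if u i = true then 1 else 0) + SubChar.bw ((pre S g₀).erase i) u := by
    intro u
    rw [ShearDial.bw_eq_add_sdiff (Finset.singleton_subset_iff.2 hiP) u, bw_singleton, Finset.sdiff_singleton_eq_erase]
  have e0 : (if (false : Bool) = true then (1 : ℕ) else 0) = 0 := by decide
  have e1 : (if (true : Bool) = true then (1 : ℕ) else 0) = 1 := by decide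
  -- ★ the flip: `u i ≠ u j` and the reduced shift in the two-element residue set ⇒ the outcome is reversed
  have hflip : ∀ u ∈ Xf p S z μ, u i ≠ u j →
      ((((SubChar.bw S u + SubChar.bw ((pre S g₀).erase i) u : ℕ)) : ZMod 3) = ρ ∨
        (((SubChar.bw S u + SubChar.bw ((pre S g₀).erase i) u : ℕ)) : ZMod 3) + 1 = ρ) →
      ringWinU c y (u ∘ Equiv.swap i j) ≠ ringWinU c y u := by
    intro u hu hne hV
    rw [hpar _ (hTX u hu), hpar u hu, hR u, SubChar.bw_comp_swap hiS hjS u]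
    refine key _ _ _ ?_
    have e : (((SubChar.bw S u + (SubChar.bw ((pre S g₀).erase i) u + 1) : ℕ)) : ZMod 3) =
        (((SubChar.bw S u + SubChar.bw ((pre S g₀).erase i) u : ℕ)) : ZMod 3) + 1 := by
      push_cast; try ring
    cases hui : u i <;> cases huj : u j
    · exact absurd (hui.trans huj.symm) hne
    · -- `u i = false`, `u j = true`: the bits before the middle cuts go UP by one
      have hbwP := bw_comp_swap_of_mem_not_mem hiP hjP u
      have hPu := hPi u
      rw [hui, huj, e0, e1] at hbwP
      rw [hui, e0] at hPu
      have h1 : SubChar.bw (pre S g₀) (u ∘ Equiv.swap i j) = SubChar.bw ((pre S g₀).erase i) u + 1 := by omega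
      have h2 : SubChar.bw (pre S g₀) u = SubChar.bw ((pre S g₀).erase i) u := by omega
      rw [h1, h2, e]
      exact (flip_iff_twoSet ρ _ 1 (by decide)).2 hV
    · -- `u i = true`, `u j = false`: they go DOWN by one
      have hbwP := bw_comp_swap_of_mem_not_mem hiP hjP u
      have hPu := hPi u
      rw [hui, huj, e0, e1] at hbwP
      rw [hui, e1] at hPu
      have h1 : SubChar.bw (pre S g₀) (u ∘ Equiv.swap i j) = SubChar.bw ((pre S g₀).erase i) u := by omega
      have h2 : SubChar.bw (pre S g₀) u = SubChar.bw ((pre S g₀).erase i) u + 1 := by omega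
      rw [h1, h2, e, Bool.xor_comm]
      exact (flip_iff_twoSet ρ _ 1 (by decide)).2 hV
    · exact absurd (hui.trans huj.symm) hne
  -- the flip set
  obtain ⟨F', hF'⟩ : ∃ F' : Finset (Fin n → Bool), F' = (Xf p S z μ).filter fun u => u i ≠ u j ∧
      ((((SubChar.bw S u + SubChar.bw ((pre S g₀).erase i) u : ℕ)) : ZMod 3) = ρ ∨
        (((SubChar.bw S u + SubChar.bw ((pre S g₀).erase i) u : ℕ)) : ZMod 3) + 1 = ρ) := ⟨_, rfl⟩
  have hmemF' : ∀ u, u ∈ F' ↔ u ∈ Xf p S z μ ∧ (u i ≠ u j ∧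
      ((((SubChar.bw S u + SubChar.bw ((pre S g₀).erase i) u : ℕ)) : ZMod 3) = ρ ∨
        (((SubChar.bw S u + SubChar.bw ((pre S g₀).erase i) u : ℕ)) : ZMod 3) + 1 = ρ)) := by
    intro u; rw [hF', Finset.mem_filter]
  have hF'X : F' ⊆ Xf p S z μ := fun u hu => ((hmemF' u).1 hu).1
  have hcount : F'.card ≤ 2 * ((Xf p S z μ).filter fun u => ringWinU c y u = false).card := by
    refine card_le_two_mul_losers (Xf p S z μ) F' (fun u => u ∘ Equiv.swap i j) (fun u => ringWinU c y u)
      hF'X hTX hTT ?_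
    intro u hu
    obtain ⟨huX, hne, hV⟩ := (hmemF' u).1 hu
    exact hflip u huX hne hV
  -- ★ counting the flip set by slices over the larger free part
  have hcardQ : ((S \ pre S g₀).erase j).card = S.card - a - 1 := by
    rw [Finset.card_erase_of_mem hjQ]; omega
  have hcardP : ((pre S g₀).erase i).card = a - 1 := by
    rw [Finset.card_erase_of_mem hiP, hPcard]
  have hmain : (2 : ℝ) ^ S.card / (3 * p) - (2 : ℝ) ^ S.card * (Real.cos (Real.pi / (3 * p))) ^ L ≤ (F'.card : ℝ) := by
    rcases le_or_gt L ((S \ pre S g₀).erase j).card with hLQ | hLQ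
    · -- Q side: free part `A = (S \ P) \ {j}`
      have hAS : (S \ pre S g₀).erase j ⊆ S := (Finset.erase_subset _ _).trans Finset.sdiff_subset
      have hiA : i ∉ (S \ pre S g₀).erase j := fun h => (Finset.mem_sdiff.1 (Finset.mem_of_mem_erase h)).2 hiP
      have hjA : j ∉ (S \ pre S g₀).erase j := Finset.notMem_erase j _
      refine slice_count hp h3p hAS hz hiS hiA hij F' ?_ hLQ
      intro w hw
      rw [Finset.mem_filter] at hw
      obtain ⟨hwf, hwij⟩ := hw
      obtain ⟨b, hb⟩ := exists_bad_residue_Q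
        ((((SubChar.bw (S \ (S \ pre S g₀).erase j) w + SubChar.bw ((pre S g₀).erase i) w : ℕ)) : ZMod 3)) ρ
      refine ⟨μ - ((SubChar.bw (S \ (S \ pre S g₀).erase j) w : ℕ) : ZMod p), b, fun u hu hua hub => ?_⟩
      have huw : ∀ k, k ∉ (S \ pre S g₀).erase j → u k = w k := mem_fib.1 hu
      have hwz : ∀ k, k ∉ S \ (S \ pre S g₀).erase j → w k = z k := mem_fib.1 hwf
      have huf : u ∈ fib S z := by
        rw [mem_fib]
        intro k hk
        rw [huw k (fun h => hk (hAS h)), hwz k (fun h => hk (Finset.mem_sdiff.1 h).1)]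
      have hbwSA : SubChar.bw (S \ (S \ pre S g₀).erase j) u = SubChar.bw (S \ (S \ pre S g₀).erase j) w :=
        SubChar.bw_congr fun k hk => huw k (Finset.mem_sdiff.1 hk).2
      have hbwS : SubChar.bw S u = SubChar.bw ((S \ pre S g₀).erase j) u + SubChar.bw (S \ (S \ pre S g₀).erase j) w := by
        rw [ShearDial.bw_eq_add_sdiff hAS u, hbwSA]
      have hPe : SubChar.bw ((pre S g₀).erase i) u = SubChar.bw ((pre S g₀).erase i) w := by
        refine SubChar.bw_congr fun k hk => huw k fun hkA => ?_
        exact (Finset.mem_sdiff.1 (Finset.mem_of_mem_erase hkA)).2 (Finset.mem_of_mem_erase hk)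
      rw [hmemF', mem_Xf]
      refine ⟨⟨huf, ?_⟩, ?_, ?_⟩
      · rw [hbwS, Nat.cast_add, hua]; ring
      · rw [huw i hiA, huw j hjA]; exact hwij
      · have hc : (((SubChar.bw S u + SubChar.bw ((pre S g₀).erase i) u : ℕ)) : ZMod 3) =
            ((SubChar.bw ((S \ pre S g₀).erase j) u : ℕ) : ZMod 3) +
              (((SubChar.bw (S \ (S \ pre S g₀).erase j) w + SubChar.bw ((pre S g₀).erase i) w : ℕ)) : ZMod 3) := by
          rw [hbwS, hPe]; push_cast; try ring
        rw [hc]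
        exact hb _ hub
    · -- P side: free part `A = P \ {i}` (large since the Q side is small)
      have hLP : L ≤ ((pre S g₀).erase i).card := by omega
      have hAS : (pre S g₀).erase i ⊆ S := (Finset.erase_subset _ _).trans (pre_subset S g₀)
      have hiA : i ∉ (pre S g₀).erase i := Finset.notMem_erase i _
      have hjA : j ∉ (pre S g₀).erase i := fun h => hjP (Finset.mem_of_mem_erase h)
      refine slice_count hp h3p hAS hz hiS hiA hij F' ?_ hLP
      intro w hw
      rw [Finset.mem_filter] at hw
      obtain ⟨hwf, hwij⟩ := hw
      obtain ⟨b, hb⟩ := exists_bad_residue_P (((SubChar.bw (S \ (pre S g₀).erase i) w : ℕ)) : ZMod 3) ρ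
      refine ⟨μ - ((SubChar.bw (S \ (pre S g₀).erase i) w : ℕ) : ZMod p), b, fun u hu hua hub => ?_⟩
      have huw : ∀ k, k ∉ (pre S g₀).erase i → u k = w k := mem_fib.1 hu
      have hwz : ∀ k, k ∉ S \ (pre S g₀).erase i → w k = z k := mem_fib.1 hwf
      have huf : u ∈ fib S z := by
        rw [mem_fib]
        intro k hk
        rw [huw k (fun h => hk (hAS h)), hwz k (fun h => hk (Finset.mem_sdiff.1 h).1)]
      have hbwSA : SubChar.bw (S \ (pre S g₀).erase i) u = SubChar.bw (S \ (pre S g₀).erase i) w :=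
        SubChar.bw_congr fun k hk => huw k (Finset.mem_sdiff.1 hk).2
      have hbwS : SubChar.bw S u = SubChar.bw ((pre S g₀).erase i) u + SubChar.bw (S \ (pre S g₀).erase i) w := by
        rw [ShearDial.bw_eq_add_sdiff hAS u, hbwSA]
      rw [hmemF', mem_Xf]
      refine ⟨⟨huf, ?_⟩, ?_, ?_⟩
      · rw [hbwS, Nat.cast_add, hua]; ring
      · rw [huw i hiA, huw j hjA]; exact hwij
      · have hc : (((SubChar.bw S u + SubChar.bw ((pre S g₀).erase i) u : ℕ)) : ZMod 3) =
            ((SubChar.bw ((pre S g₀).erase i) u : ℕ) : ZMod 3) +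
              (((SubChar.bw (S \ (pre S g₀).erase i) w : ℕ)) : ZMod 3) +
              ((SubChar.bw ((pre S g₀).erase i) u : ℕ) : ZMod 3) := by
          rw [hbwS]; push_cast; try ring
        rw [hc]
        exact hb _ hub
  -- assemble
  have hcountR : (F'.card : ℝ) ≤ 2 * (((Xf p S z μ).filter fun u => ringWinU c y u = false).card : ℝ) := by
    exact_mod_cast hcount
  have hnn : (0 : ℝ) ≤ (2 : ℝ) ^ S.card * (Real.cos (Real.pi / (3 * p))) ^ L :=
    mul_nonneg (by positivity) (pow_nonneg hC0 L)
  have hp0 : (0 : ℝ) < p := by exact_mod_cast hp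
  have hpne : (p : ℝ) ≠ 0 := hp0.ne'
  have h6 : (2 : ℝ) ^ S.card / (6 * p) = ((2 : ℝ) ^ S.card / (3 * p)) / 2 := by
    field_simp; ring
  rw [h6]
  linarith

end Law

end Summit.QuantumAdvantage.QuantumAdvantage.Theorems.ColumnDial
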